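import Summits.AtomisticToContinuum.FouriersLaw.Theses.VanishingNoiseTransfer
import Literature.MathematicalPhysics.KineticTheory.VelocityFlipNoise

/-!
# Disproof of `VanishingNoiseBound` — findings

Work file of the standing crux disprover (`cdisprove-stmt-AtomisticToContinuum-11976`).
Crux: `Summit.AtomisticToContinuum.FouriersLaw.Theses.VanishingNoiseTransfer.VanishingNoiseBound`
(item `stmt-AtomisticToContinuum-11976`, rank-3 crux of route `VanishingNoiseTransfer`).

INDEX (prose lives in the docstrings of the declarations named here):
* §0 `CruxAt`, `crux_iff_cruxAt` — the crux with the inlined flip predicate `S` NAMED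
  (`OscillatorChain.IsFlipSteadyState`), per parameter/temperature.
* §0 also: `bondCurrent_one`, `totalCurrent_one`, `response_eq_zero_of_le_one` — junk lengths
  `N ≤ 1` are inert (`D 0 = D 1 = 0` for ANY family).
* §1 `noisyKappaSet`, `noisyKappaSet_subsingleton`, `cruxAt_iff_bddAbove` — what the crux SAYS:
  at fixed `ε` the unique noisy family pins the response sequence and its limit, so the crux is
  exactly `∃ ε₁ > 0, BddAbove {κ_ε(T) : ε ∈ (0, ε₁], κ_ε(T) defined}`.
* §1b `crux_of_fouriersLaw_of_noiseLocality` — NO SLACK: `FouriersLaw ∧ NoiseLocality →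
  VanishingNoiseBound` (pure real analysis, `K = 2κ(T)`); with the route's `closes`, modulo the
  sibling crux the item IS `κ(0) < ∞` — a counterexample inside `0 < ω₂, lam, β` would disprove
  Fourier's law for `pinnedChain` (or noise locality).
* §1c `cruxAt_of_antitone_response` — the comparison-principle route ("flips never increase the
  finite-`N` response" + bounded deterministic response ⇒ crux), with the WARNING that the
  principle fails for disordered chains (noise-assisted transport).
* §1d `cruxAt_iff_bddAbove_kappa` — OPERATIONAL FORM given the sibling `NoisyFourier`
  (unique noisy family + convergent responses `→ κ ε`): the crux is exactly
  `∃ K ε₁ > 0, ∀ ε ∈ (0, ε₁], κ ε ≤ K` — one inequality, uniform in small `ε`.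
* §2 `cruxPointwiseAt_holds` — the `ε`-POINTWISE weakening (`∀ ε ∃ K`) is a THEOREM of pure
  logic: all content of the crux is the uniformity in `ε ↓ 0`.
  `cruxWithoutEps1PosAt_holds` — dropping `0 < ε₁` makes the crux vacuous (take `ε₁ = 0`).
* §3 LOAD-BEARING hypotheses: `crux_false_without_SBinding` (the defining equation of `S` carries
  everything: with `S` free, the harmonic caricature `κ_ε = 1/ε` realised by Dirac families is a
  counterexample); `cruxAt_zero_false_of_exists_unique` (dropping `0 < T`: at `T = 0` the
  family hypothesis does not bind `μ N (δ/2) (-δ/2)`, junk escape — conditional on noisy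
  existence/uniqueness, i.e. on `NoisyFourier` (i)); `cruxAt_iff_forall_families_of_unique`
  (the uniqueness clause is inert given `NoisyFourier` (i)).
* §4 NEAR-MISSES: `cruxAt_false_of_inv_lower_bound` (sorry-free: ANY lower bound `κ_ε ≥ c/ε`
  along `ε ↓ 0` kills the crux — the harmonic/Mazur shape); the harmonic corner `lam = β = 0`
  (`κ_ε = c/ε`, Bernardin–Olla 2011 Thm 3, Bernardin–Kannan–Lebowitz–Lukkarinen 2012 §2):
  `cruxAt_false_harmonic`, sorry-free MODULO the one sorried printed fact
  `harmonic_noisyKappa_BKLL2012`; the unpinned corner (`κ_ε ~ ε^{-0.52}` numerically, Landi–de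
  Oliveira 2013) as the conjecture `UnpinnedCornerFails` — both corners EXCLUDED by `0 < lam`,
  `0 < β`, `0 < ω₂`.
* §5 NUMERICS (kit jobs, ids in the docstring of `numerics_log`): NEMD tables of `D_N(ε)`.
* §6 WHY IT RESISTS — docstring of `verdict`.
-/

noncomputable section

namespace Summit.AtomisticToContinuum.FouriersLaw.Cruxes.VanishingNoiseBound.Disproof

open MeasureTheory Filter Topology Set
open Literature.MathematicalPhysics.KineticTheory.HeatConduction
open Summit.AtomisticToContinuum.FouriersLaw.Theses.VanishingNoiseTransfer (VanishingNoiseBound)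

/-! ## §0 The crux with the flip predicate named -/

/-- `IsUniqueFlipFamily P ε μ`: `μ N T_L T_R` is, for all `N` and all `T_L, T_R > 0`, THE unique
weak steady state of the flip-noisy chain `L + εS` (the family hypothesis of the crux, with the
inlined predicate `S ε N T_L T_R` replaced by `P.IsFlipSteadyState N T_L T_R ε` — the same term,
`OscillatorChain.isFlipSteadyState_fun_eq`). -/
def IsUniqueFlipFamily (P : OscillatorChain) (ε : ℝ)
    (μ : (N : ℕ) → ℝ → ℝ → Measure (PhaseSpace N)) : Prop :=
  ∀ (N : ℕ) (T_L T_R : ℝ), 0 < T_L → 0 < T_R →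
    P.IsFlipSteadyState N T_L T_R ε (μ N T_L T_R) ∧
      ∀ ν : Measure (PhaseSpace N), P.IsFlipSteadyState N T_L T_R ε ν → ν = μ N T_L T_R

/-- `IsResponse P μ T D`: `D N` is the linear-response coefficient of the family `μ` at length `N`
and temperature `T`: `totalCurrent(μ_{N, T+δ/2, T-δ/2})/δ → D N` as `δ → 0`, `δ ≠ 0`. -/
def IsResponse (P : OscillatorChain) (μ : (N : ℕ) → ℝ → ℝ → Measure (PhaseSpace N)) (T : ℝ)
    (D : ℕ → ℝ) : Prop :=
  ∀ N : ℕ, Tendsto (fun δ : ℝ => P.totalCurrent (μ N (T + δ / 2) (T - δ / 2)) / δ)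
    (𝓝[≠] 0) (𝓝 (D N))

/-- The crux at fixed chain `P` and temperature `T`: `∃ K, ε₁ > 0` such that for every
`ε ∈ (0, ε₁]`, every unique flip-steady family at rate `ε`, every response sequence `D` and
every limit `k` of `D`: `k ≤ K`. -/
def CruxAt (P : OscillatorChain) (T : ℝ) : Prop :=
  ∃ K ε₁ : ℝ, 0 < ε₁ ∧ ∀ ε : ℝ, 0 < ε → ε ≤ ε₁ →
    ∀ μ : (N : ℕ) → ℝ → ℝ → Measure (PhaseSpace N), IsUniqueFlipFamily P ε μ →
      ∀ (D : ℕ → ℝ) (k : ℝ), IsResponse P μ T D → Tendsto D atTop (𝓝 k) → k ≤ K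

/-- **The crux, named.** `VanishingNoiseBound` is `CruxAt (pinnedChain ω₂ lam β γ) T` for all
positive parameters and temperatures (the binder `S` and its defining equation are eliminated by
`subst`; the inlined predicate is `IsFlipSteadyState` by `rfl`). -/
theorem crux_iff_cruxAt :
    VanishingNoiseBound ↔ ∀ ω₂ lam β γ : ℝ, 0 < ω₂ → 0 < lam → 0 < β → 0 < γ →
      ∀ T : ℝ, 0 < T → CruxAt (pinnedChain ω₂ lam β γ) T := by
  constructor
  · intro h ω₂ lam β γ hω hl hβ hγ T hT
    obtain ⟨K, ε₁, hε₁, hK⟩ := h ω₂ lam β γ hω hl hβ hγ _ rfl T hT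
    exact ⟨K, ε₁, hε₁, fun ε hε hε' μ hμ D k hD hk => hK ε hε hε' μ hμ D k hD hk⟩
  · intro h ω₂ lam β γ hω hl hβ hγ S hS T hT
    subst hS
    obtain ⟨K, ε₁, hε₁, hK⟩ := h ω₂ lam β γ hω hl hβ hγ T hT
    exact ⟨K, ε₁, hε₁, fun ε hε hε' μ hμ D k hD hk => hK ε hε hε' μ hμ D k hD hk⟩

/-- A one-site chain has no bond: every bond current vanishes identically at `N = 1`. -/
theorem bondCurrent_one (P : OscillatorChain) (i : Fin 1) (x : PhaseSpace 1) :
    P.bondCurrent 1 i x = 0 := by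
  unfold OscillatorChain.bondCurrent
  refine Finset.sum_eq_zero fun j _ => ?_
  rw [if_neg]
  have hi := i.isLt
  have hj := j.isLt
  omega

/-- … hence the total current of ANY measure vanishes at `N = 1` (as at `N = 0`,
`OscillatorChain.totalCurrent_zero`). -/
theorem totalCurrent_one (P : OscillatorChain) (μ : Measure (PhaseSpace 1)) :
    P.totalCurrent μ = 0 := by
  unfold OscillatorChain.totalCurrent
  simp [bondCurrent_one]

/-- **Junk lengths are inert.** Whatever the family, the response coefficients at `N = 0` and
`N = 1` are `0` (no bond carries current), so the crux's limit `k = lim_N D N` never sees them;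
the content starts at `N ≥ 2`, where no flip-steady state other than the equilibrium Gibbs
measure is available in the tree. -/
theorem response_eq_zero_of_le_one (P : OscillatorChain)
    (μ : (N : ℕ) → ℝ → ℝ → Measure (PhaseSpace N)) (T : ℝ) (D : ℕ → ℝ)
    (hD : IsResponse P μ T D) {N : ℕ} (hN : N ≤ 1) : D N = 0 := by
  have hzero : ∀ δ : ℝ, P.totalCurrent (μ N (T + δ / 2) (T - δ / 2)) / δ = 0 := by
    intro δ
    interval_cases N
    · simp
    · simp [totalCurrent_one]
  have h := hD N
  simp only [hzero] at h
  exact tendsto_nhds_unique h tendsto_const_nhds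

/-! ## §1 What the crux says: the noisy conductivity set at rate `ε` is a subsingleton -/

/-- Two unique flip-steady families agree at all positive temperatures. -/
theorem IsUniqueFlipFamily.eq_of_pos {P : OscillatorChain} {ε : ℝ}
    {μ μ' : (N : ℕ) → ℝ → ℝ → Measure (PhaseSpace N)}
    (h : IsUniqueFlipFamily P ε μ) (h' : IsUniqueFlipFamily P ε μ') {N : ℕ} {T_L T_R : ℝ}
    (hL : 0 < T_L) (hR : 0 < T_R) : μ N T_L T_R = μ' N T_L T_R :=
  (h' N T_L T_R hL hR).2 _ (h N T_L T_R hL hR).1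

/-- Response coefficients only see the family near `δ = 0`, where both temperatures `T ± δ/2` are
positive (`|δ| < 2T`): two families agreeing at positive temperatures have the same responses. -/
theorem IsResponse.unique {P : OscillatorChain} {μ μ' : (N : ℕ) → ℝ → ℝ → Measure (PhaseSpace N)}
    {T : ℝ} {D D' : ℕ → ℝ} (hT : 0 < T)
    (hμ : ∀ (N : ℕ) (T_L T_R : ℝ), 0 < T_L → 0 < T_R → μ N T_L T_R = μ' N T_L T_R)
    (hD : IsResponse P μ T D) (hD' : IsResponse P μ' T D') : D = D' := by
  funext N
  have h1 : ∀ᶠ δ in 𝓝 (0 : ℝ), δ < 2 * T := eventually_lt_nhds (by linarith)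
  have h2 : ∀ᶠ δ in 𝓝 (0 : ℝ), -(2 * T) < δ := eventually_gt_nhds (by linarith)
  have hev : ∀ᶠ δ in 𝓝[≠] (0 : ℝ),
      P.totalCurrent (μ N (T + δ / 2) (T - δ / 2)) / δ =
        P.totalCurrent (μ' N (T + δ / 2) (T - δ / 2)) / δ := by
    refine ((h1.and h2).filter_mono nhdsWithin_le_nhds).mono fun δ hδ => ?_
    rw [hμ N _ _ (by linarith [hδ.2]) (by linarith [hδ.1])]
  exact tendsto_nhds_unique ((hD N).congr' hev) (hD' N)

/-- The set of noisy conductivities `κ_ε(T)` the crux quantifies over at rate `ε`: limits `k` of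
response sequences `D` of unique flip-steady families at rate `ε`. -/
def noisyKappaSet (P : OscillatorChain) (T ε : ℝ) : Set ℝ :=
  {k | ∃ (μ : (N : ℕ) → ℝ → ℝ → Measure (PhaseSpace N)) (D : ℕ → ℝ),
    IsUniqueFlipFamily P ε μ ∧ IsResponse P μ T D ∧ Tendsto D atTop (𝓝 k)}

/-- **At fixed rate the crux quantifies over at most ONE number.** Uniqueness of the noisy family
(part of the hypothesis) pins `D` and hence `k`: `noisyKappaSet P T ε` is a subsingleton. No
steady-state theory is used — pure bookkeeping. -/
theorem noisyKappaSet_subsingleton (P : OscillatorChain) {T : ℝ} (hT : 0 < T) (ε : ℝ) :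
    (noisyKappaSet P T ε).Subsingleton := by
  rintro k ⟨μ, D, hμ, hD, hk⟩ k' ⟨μ', D', hμ', hD', hk'⟩
  have hDD' : D = D' :=
    IsResponse.unique hT (fun N T_L T_R hL hR => hμ.eq_of_pos hμ' hL hR) hD hD'
  subst hDD'
  exact tendsto_nhds_unique hk hk'

/-- **Reformulation.** The crux at `(P, T)` says exactly: for some `ε₁ > 0` the noisy
conductivities `κ_ε(T)`, `ε ∈ (0, ε₁]` (where defined) are bounded above. -/
theorem cruxAt_iff_bddAbove (P : OscillatorChain) (T : ℝ) :
    CruxAt P T ↔ ∃ ε₁ : ℝ, 0 < ε₁ ∧ BddAbove (⋃ ε ∈ Ioc (0 : ℝ) ε₁, noisyKappaSet P T ε) := by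
  constructor
  · rintro ⟨K, ε₁, hε₁, hK⟩
    refine ⟨ε₁, hε₁, K, fun k hk => ?_⟩
    obtain ⟨ε, ⟨hε, hε'⟩, μ, D, hμ, hD, hk⟩ := mem_iUnion₂.mp hk
    exact hK ε hε hε' μ hμ D k hD hk
  · rintro ⟨ε₁, hε₁, K, hK⟩
    exact ⟨K, ε₁, hε₁, fun ε hε hε' μ hμ D k hD hk =>
      hK (mem_iUnion₂.mpr ⟨ε, ⟨hε, hε'⟩, μ, D, hμ, hD, hk⟩)⟩

/-! ## §1b Tightness: the crux is NECESSARY — it follows from the target plus the sibling crux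
`NoiseLocality` (so, modulo `NoiseLocality`, refuting it means refuting Fourier's law itself) -/

open Summit.AtomisticToContinuum.FouriersLaw.Theses.VanishingNoiseTransfer (NoiseLocality) in
/-- **No slack in the crux.** `FouriersLaw ∧ NoiseLocality → VanishingNoiseBound`, by pure real
analysis: if `D⁰_N → κ(T) ∈ (0,∞)` (Fourier's law for the deterministic chain) and
`|D⁰_N - D^ε_N| ≤ w(ε)|D⁰_N||D^ε_N|` with `w(ε) → 0` (noise locality), then for `ε` so small that
`|w(ε)| < 1/(2κ(T))` every noisy limit `k = lim_N D^ε_N` satisfies `|1/k - 1/κ(T)| ≤ |w(ε)|`, hence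
`k ≤ 2κ(T) =: K`. Together with the route's proved `closes`
(`NoiseLocality → VanishingNoiseBound → NoisyFourier → NessUnique → FiniteResponseOfUnique →
FouriersLaw`) this pins the crux: GIVEN the sibling `NoiseLocality` (and the print-level
supports), `VanishingNoiseBound ↔ κ(0) < ∞`, i.e. a disproof of this crux is a disproof either of
`NoiseLocality` or of the conjunct `FouriersLaw` for the pinned anharmonic chain — which is why no
cheap counterexample exists inside the hypotheses `0 < ω₂, lam, β`. -/
theorem crux_of_fouriersLaw_of_noiseLocality (hFL : _root_.FouriersLaw) (hNL : NoiseLocality) :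
    VanishingNoiseBound := by
  classical
  intro ω₂ lam β γ hω hl hβ hγ S hS T hT
  obtain ⟨hex, κ, hκpos, hresp⟩ := hFL ω₂ lam β γ hω hl hβ hγ
  -- the unique deterministic steady family, by choice
  let μ0 : (N : ℕ) → ℝ → ℝ → Measure (PhaseSpace N) := fun N T_L T_R =>
    if h : 0 < T_L ∧ 0 < T_R then Classical.choose (hex N T_L T_R h.1 h.2) else 0
  have hμ0 : ∀ (N : ℕ) (T_L T_R : ℝ), 0 < T_L → 0 < T_R →
      (pinnedChain ω₂ lam β γ).IsSteadyState N T_L T_R (μ0 N T_L T_R) ∧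
        ∀ ν : Measure (PhaseSpace N),
          (pinnedChain ω₂ lam β γ).IsSteadyState N T_L T_R ν → ν = μ0 N T_L T_R := by
    intro N T_L T_R hL hR
    have h := Classical.choose_spec (hex N T_L T_R hL hR)
    simp only [μ0, dif_pos (And.intro hL hR)]
    exact h
  obtain ⟨D0, hD0, hD0lim⟩ := hresp μ0 (fun N T_L T_R hL hR => (hμ0 N T_L T_R hL hR).1) T hT
  obtain ⟨w, hw, hloc⟩ := hNL ω₂ lam β γ hω hl hβ hγ S hS T hT
  have hκ : 0 < κ T := hκpos T hT
  -- choose ε₁ with |w ε| < 1/(2 κ T) on (0, ε₁]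
  have hwev : ∀ᶠ ε in 𝓝[>] (0 : ℝ), |w ε| < 1 / (2 * κ T) := by
    have h := Metric.tendsto_nhds.mp hw (1 / (2 * κ T)) (by positivity)
    simpa only [Real.dist_eq, sub_zero] using h
  obtain ⟨u, hu, hsub⟩ := mem_nhdsGT_iff_exists_Ioo_subset.mp hwev
  have hu0 : 0 < u := hu
  refine ⟨2 * κ T, min (u / 2) 1, lt_min (half_pos hu0) one_pos, ?_⟩
  intro ε hε hεle μ hμ D k hD hk
  have hεu : ε < u := by
    have := min_le_left (u / 2) 1
    linarith
  have hε1 : ε ≤ 1 := le_trans hεle (min_le_right _ _)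
  have hwε : |w ε| < 1 / (2 * κ T) := hsub ⟨hε, hεu⟩
  by_cases hkpos : 0 < k
  swap
  · linarith
  -- noise locality at every length, between the deterministic family and the given noisy one
  have hlocN : ∀ N : ℕ, |D0 N - D N| ≤ w ε * |D0 N| * |D N| := fun N =>
    hloc N ε hε hε1 (μ0 N) (fun T_L T_R => μ N T_L T_R) (hμ0 N) (hμ N) (D0 N) (D N) (hD0 N)
      (hD N)
  -- pass to the limit N → ∞ in |1/D N - 1/D0 N| ≤ |w ε|
  have h1 : ∀ᶠ N in atTop, κ T / 2 < D0 N := hD0lim.eventually_const_lt (by linarith)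
  have h2 : ∀ᶠ N in atTop, k / 2 < D N := hk.eventually_const_lt (by linarith)
  have hev : ∀ᶠ N in atTop, |(D N)⁻¹ - (D0 N)⁻¹| ≤ |w ε| := by
    filter_upwards [h1, h2] with N hN1 hN2
    have hD0pos : 0 < D0 N := by linarith
    have hDpos : 0 < D N := by linarith
    have hprod : 0 < |D0 N| * |D N| := mul_pos (abs_pos.mpr hD0pos.ne') (abs_pos.mpr hDpos.ne')
    have heq : (D N)⁻¹ - (D0 N)⁻¹ = (D0 N - D N) / (D0 N * D N) := by
      field_simp
    rw [heq, abs_div, abs_mul, div_le_iff₀ hprod]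
    calc |D0 N - D N| ≤ w ε * |D0 N| * |D N| := hlocN N
      _ ≤ |w ε| * |D0 N| * |D N| := by gcongr; exact le_abs_self _
      _ = |w ε| * (|D0 N| * |D N|) := by ring
  have hlim : Tendsto (fun N => |(D N)⁻¹ - (D0 N)⁻¹|) atTop (𝓝 |k⁻¹ - (κ T)⁻¹|) :=
    ((hk.inv₀ hkpos.ne').sub (hD0lim.inv₀ hκ.ne')).abs
  have hle : |k⁻¹ - (κ T)⁻¹| ≤ |w ε| := le_of_tendsto hlim hev
  have hlt : |k⁻¹ - (κ T)⁻¹| < 1 / (2 * κ T) := lt_of_le_of_lt hle hwε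
  have hk_inv : (κ T)⁻¹ - 1 / (2 * κ T) < k⁻¹ := by
    have := (abs_lt.mp hlt).1
    linarith
  have hhalf : (κ T)⁻¹ - 1 / (2 * κ T) = (2 * κ T)⁻¹ := by
    field_simp
    ring
  rw [hhalf] at hk_inv
  exact le_of_lt ((inv_lt_inv₀ (by positivity) hkpos).mp hk_inv)

/-! ## §1c The other sufficient path: a comparison principle ("flips never increase the current") -/

/-- **Monotone route.** If ONE deterministic family has responses `D0` at `T` that are
bounded in `N` (`HasBoundedResponse`-type input, e.g. from Fourier's law) and flips never increase
the finite-`N` response — `D^ε_N ≤ D⁰_N` for every `ε ∈ (0,1]` and every unique flip-steady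
family ("Matthiessen monotonicity", a comparison principle) — then the crux holds with
`K = sup_N |D⁰_N|`, `ε₁ = 1`. WARNING (why this is not a free lunch): the comparison principle is
FALSE as a general fact about chains — for the disordered pinned harmonic chain the
deterministic current is exponentially small in `N` (localisation) while flips restore a
conductivity `κ_ε = O(ε) > 0` (Bernardin–Huveneers 2013; Dhar–Venkateshan–Lebowitz 2011), so noise
INCREASES the current there; for the ordered anharmonic chain at small `N` noise-assisted
transfer across anharmonic resonance gaps is conceivable (tested numerically: kit jobs j012957 /
j012960, sets `smallN…`, see `numerics_log`). Any use of this route must exploit order +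
anharmonicity. -/
theorem cruxAt_of_antitone_response (P : OscillatorChain) (T : ℝ) (D0 : ℕ → ℝ)
    (hbdd : BddAbove (Set.range fun N => |D0 N|))
    (hmono : ∀ ε : ℝ, 0 < ε → ε ≤ 1 →
      ∀ μ : (N : ℕ) → ℝ → ℝ → Measure (PhaseSpace N), IsUniqueFlipFamily P ε μ →
        ∀ D : ℕ → ℝ, IsResponse P μ T D → ∀ N, D N ≤ D0 N) :
    CruxAt P T := by
  obtain ⟨K, hK⟩ := hbdd
  refine ⟨K, 1, one_pos, fun ε hε hε1 μ hμ D k hD hk => ?_⟩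
  refine le_of_tendsto' hk fun N => ?_
  calc D N ≤ D0 N := hmono ε hε hε1 μ hμ D hD N
    _ ≤ |D0 N| := le_abs_self _
    _ ≤ K := hK ⟨N, rfl⟩

/-! ## §1d Operational form given the sibling `NoisyFourier`: bound ONE function `ε ↦ κ_ε(T)` -/

/-- **Operational form.** If at every rate `ε ∈ (0, ε₀]` the noisy chain has a unique
flip-steady family whose responses at `T` converge to a number `κ ε` (this is what the sibling
crux `NoisyFourier` provides, with `κ ε = κ_ε(T) > 0`), then the crux at `(P, T)` is EXACTLY the
statement that `κ` is bounded above on some `(0, ε₁]`. So the prover's whole task is one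
inequality `κ_ε(T) ≤ K` uniform in small `ε` — and the disprover's whole task is `κ_{ε_n}(T) → ∞`
along some `ε_n ↓ 0` (cf. `cruxAt_false_of_inv_lower_bound`). -/
theorem cruxAt_iff_bddAbove_kappa (P : OscillatorChain) {T : ℝ} (hT : 0 < T) (κ : ℝ → ℝ)
    {ε₀ : ℝ} (hε₀ : 0 < ε₀)
    (hex : ∀ ε : ℝ, 0 < ε → ε ≤ ε₀ →
      ∃ μ : (N : ℕ) → ℝ → ℝ → Measure (PhaseSpace N), IsUniqueFlipFamily P ε μ)
    (hconv : ∀ ε : ℝ, 0 < ε → ε ≤ ε₀ →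
      ∀ μ : (N : ℕ) → ℝ → ℝ → Measure (PhaseSpace N), IsUniqueFlipFamily P ε μ →
        ∃ D : ℕ → ℝ, IsResponse P μ T D ∧ Tendsto D atTop (𝓝 (κ ε))) :
    CruxAt P T ↔ ∃ K ε₁ : ℝ, 0 < ε₁ ∧ ∀ ε : ℝ, 0 < ε → ε ≤ ε₁ → κ ε ≤ K := by
  constructor
  · rintro ⟨K, ε₁, hε₁, hK⟩
    refine ⟨K, min ε₁ ε₀, lt_min hε₁ hε₀, fun ε hε hεle => ?_⟩
    have hε₁' : ε ≤ ε₁ := le_trans hεle (min_le_left _ _)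
    have hε₀' : ε ≤ ε₀ := le_trans hεle (min_le_right _ _)
    obtain ⟨μ, hμ⟩ := hex ε hε hε₀'
    obtain ⟨D, hD, hDlim⟩ := hconv ε hε hε₀' μ hμ
    exact hK ε hε hε₁' μ hμ D (κ ε) hD hDlim
  · rintro ⟨K, ε₁, hε₁, hK⟩
    refine ⟨K, min ε₁ ε₀, lt_min hε₁ hε₀, fun ε hε hεle μ hμ D k hD hk => ?_⟩
    have hε₁' : ε ≤ ε₁ := le_trans hεle (min_le_left _ _)
    have hε₀' : ε ≤ ε₀ := le_trans hεle (min_le_right _ _)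
    obtain ⟨D', hD', hD'lim⟩ := hconv ε hε hε₀' μ hμ
    have hkκ : k = κ ε :=
      noisyKappaSet_subsingleton P hT ε ⟨μ, D, hμ, hD, hk⟩ ⟨μ, D', hμ, hD', hD'lim⟩
    rw [hkκ]
    exact hK ε hε hε₁'

/-! ## §2 Weakenings that hold trivially: all content is the uniformity in `ε ↓ 0` -/

/-- The `ε`-POINTWISE weakening of the crux: for each rate separately a bound exists. -/
def CruxPointwiseAt (P : OscillatorChain) (T : ℝ) : Prop :=
  ∀ ε : ℝ, 0 < ε → ∃ K : ℝ,
    ∀ μ : (N : ℕ) → ℝ → ℝ → Measure (PhaseSpace N), IsUniqueFlipFamily P ε μ →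
      ∀ (D : ℕ → ℝ) (k : ℝ), IsResponse P μ T D → Tendsto D atTop (𝓝 k) → k ≤ K

/-- **The pointwise weakening is a theorem of pure logic** (for EVERY chain `P`, no dynamics): at
fixed `ε` there is at most one admissible `k` (`noisyKappaSet_subsingleton`), so `K := k` (or `0`)
works. Hence every bit of content of `VanishingNoiseBound` is the UNIFORMITY of `K` over
`ε ∈ (0, ε₁]`, i.e. `limsup_{ε ↓ 0} κ_ε(T) < ∞`; a prover gains nothing from fixed-`ε` estimates
(Bernardin–Olla 2011 Prop. 4, `κ_ε ≤ Var(V′)/(4εT)`) unless they are uniform. -/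
theorem cruxPointwiseAt_holds (P : OscillatorChain) {T : ℝ} (hT : 0 < T) : CruxPointwiseAt P T := by
  intro ε _hε
  by_cases h : (noisyKappaSet P T ε).Nonempty
  · obtain ⟨k₀, hk₀⟩ := h
    exact ⟨k₀, fun μ hμ D k hD hk =>
      le_of_eq (noisyKappaSet_subsingleton P hT ε ⟨μ, D, hμ, hD, hk⟩ hk₀)⟩
  · exact ⟨0, fun μ hμ D k hD hk => absurd ⟨k, μ, D, hμ, hD, hk⟩ h⟩

/-- The crux with the side condition `0 < ε₁` dropped. -/
def CruxWithoutEps1PosAt (P : OscillatorChain) (T : ℝ) : Prop :=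
  ∃ K ε₁ : ℝ, ∀ ε : ℝ, 0 < ε → ε ≤ ε₁ →
    ∀ μ : (N : ℕ) → ℝ → ℝ → Measure (PhaseSpace N), IsUniqueFlipFamily P ε μ →
      ∀ (D : ℕ → ℝ) (k : ℝ), IsResponse P μ T D → Tendsto D atTop (𝓝 k) → k ≤ K

/-- **Without `0 < ε₁` the crux is vacuous** (`ε₁ := 0` empties the range of `ε`): the positivity
of `ε₁` is the only thing preventing a junk proof. -/
theorem cruxWithoutEps1PosAt_holds (P : OscillatorChain) (T : ℝ) : CruxWithoutEps1PosAt P T :=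
  ⟨0, 0, fun _ε hε hε' _ _ _ _ _ _ => absurd hε' (not_le.mpr hε)⟩

/-! ## §3 Load-bearing hypotheses: explicit Dirac families with prescribed currents -/

/-- The phase point with stretch `1` on the bond `(0,1)` only and momentum `a` at site `0` only:
`q = (0, 1, 1, …, 1)`, `p = (a, 0, …, 0)`. Its only non-zero bond current is
`j_0 = -(a/2) V′(1)`. -/
def pt (N : ℕ) (a : ℝ) : PhaseSpace N :=
  (fun j => if j.val = 0 then 0 else 1, fun j => if j.val = 0 then a else 0)

/-- Bonds not touching site `0` carry no current at `pt N a` (both momenta vanish). -/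
theorem bondCurrent_pt_of_ne_zero (P : OscillatorChain) {N : ℕ} (a : ℝ) (i : Fin N)
    (hi : i.val ≠ 0) : P.bondCurrent N i (pt N a) = 0 := by
  unfold OscillatorChain.bondCurrent pt
  refine Finset.sum_eq_zero fun j _ => ?_
  split_ifs with hj
  · have hj0 : j.val ≠ 0 := by omega
    simp [hi, hj0]
  · rfl

/-- The bond `(0,1)` carries the current `-(a/2)·V′(1)` at `pt (n+2) a`. -/
theorem bondCurrent_pt_zero (P : OscillatorChain) (n : ℕ) (a : ℝ) :
    P.bondCurrent (n + 2) ⟨0, by omega⟩ (pt (n + 2) a) = -(a / 2 * deriv P.V 1) := by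
  unfold OscillatorChain.bondCurrent pt
  rw [Finset.sum_eq_single ⟨1, by omega⟩]
  · simp
  · intro j _ hj
    rw [if_neg]
    intro h
    exact hj (Fin.ext (by simpa using h))
  · intro h
    exact absurd (Finset.mem_univ _) h

/-- Total current of the Dirac mass at `pt N a`: `-(a/2)·V′(1)` once there is a bond (`N ≥ 2`),
`0` for `N ≤ 1`. -/
theorem totalCurrent_dirac_pt (P : OscillatorChain) (N : ℕ) (a : ℝ) :
    P.totalCurrent (Measure.dirac (pt N a)) = if 2 ≤ N then -(a / 2 * deriv P.V 1) else 0 := by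
  unfold OscillatorChain.totalCurrent
  simp only [integral_dirac]
  match N with
  | 0 => simp
  | 1 =>
    simp only [Finset.univ_unique, Finset.sum_singleton]
    rw [if_neg (by omega)]
    unfold OscillatorChain.bondCurrent
    refine Finset.sum_eq_zero fun j _ => ?_
    rw [if_neg]
    have := j.isLt
    simp only [Fin.val_eq_zero, Fin.default_eq_zero]
    omega
  | n + 2 =>
    rw [if_pos (by omega), Finset.sum_eq_single ⟨0, by omega⟩]
    · exact bondCurrent_pt_zero P n a
    · intro i _ hi
      exact bondCurrent_pt_of_ne_zero P a i (fun h => hi (Fin.ext h))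
    · intro h
      exact absurd (Finset.mem_univ _) h

/-- **The harmonic caricature as a Dirac family.** `caricature P ε N T_L T_R` is the point mass at
`pt N a` with `a` tuned so that its total current is `(T_L - T_R)/ε` (for `N ≥ 2`, provided
`V′(1) ≠ 0`): the response coefficient is `D_N(ε) = 1/ε` for `N ≥ 2`, hence `κ_ε = 1/ε ↑ ∞` as
`ε ↓ 0` — the shape of the printed harmonic law `κ_ε = c/ε` (Bernardin–Olla 2011 Thm 3;
Bernardin–Kannan–Lebowitz–Lukkarinen 2012 §2), realised by junk measures. -/
def caricature (P : OscillatorChain) (ε : ℝ) (N : ℕ) (T_L T_R : ℝ) : Measure (PhaseSpace N) :=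
  Measure.dirac (pt N (-(2 * (T_L - T_R)) / (ε * deriv P.V 1)))

theorem totalCurrent_caricature (P : OscillatorChain) (hV : deriv P.V 1 ≠ 0) {ε : ℝ} (hε : ε ≠ 0)
    (N : ℕ) (T_L T_R : ℝ) :
    P.totalCurrent (caricature P ε N T_L T_R) = if 2 ≤ N then (T_L - T_R) / ε else 0 := by
  unfold caricature
  rw [totalCurrent_dirac_pt]
  split_ifs
  · field_simp
  · rfl

/-- The response sequence of the caricature at ANY temperature `T`: `D_N = 1/ε` for `N ≥ 2`,
`0` for `N ≤ 1`. -/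
theorem isResponse_caricature (P : OscillatorChain) (hV : deriv P.V 1 ≠ 0) {ε : ℝ} (hε : ε ≠ 0)
    (T : ℝ) : IsResponse P (caricature P ε) T (fun N => if 2 ≤ N then 1 / ε else 0) := by
  intro N
  simp only [totalCurrent_caricature P hV hε]
  refine (tendsto_const_nhds (x := if 2 ≤ N then 1 / ε else 0)).congr' ?_
  filter_upwards [self_mem_nhdsWithin] with δ hδ
  rw [Set.mem_compl_iff, Set.mem_singleton_iff] at hδ
  split_ifs
  · field_simp
    ring
  · simp

/-- … and its limit is `1/ε`. -/
theorem tendsto_caricature_response (ε : ℝ) :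
    Tendsto (fun N : ℕ => if 2 ≤ N then 1 / ε else 0) atTop (𝓝 (1 / ε)) := by
  refine (tendsto_const_nhds (x := 1 / ε)).congr' ?_
  filter_upwards [Filter.eventually_ge_atTop 2] with N hN
  rw [if_pos hN]

/-- Elementary: for every `K` and `ε₁ > 0` there is a rate `ε ∈ (0, ε₁]` with `K < 1/ε`. -/
theorem exists_rate_inv_gt (K : ℝ) {ε₁ : ℝ} (hε₁ : 0 < ε₁) :
    ∃ ε : ℝ, 0 < ε ∧ ε ≤ ε₁ ∧ K < 1 / ε := by
  have hK1 : 0 < |K| + 1 := by positivity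
  refine ⟨min ε₁ (1 / (|K| + 1)), lt_min hε₁ (by positivity), min_le_left _ _, ?_⟩
  have hpos : 0 < min ε₁ (1 / (|K| + 1)) := lt_min hε₁ (by positivity)
  calc K ≤ |K| := le_abs_self K
    _ < |K| + 1 := lt_add_one _
    _ = 1 / (1 / (|K| + 1)) := by field_simp
    _ ≤ 1 / min ε₁ (1 / (|K| + 1)) := by
        gcongr
        exact min_le_right _ _

/-- The crux with the defining equation `S = (flip-steady predicate)` DROPPED, i.e. quantified
over an ARBITRARY steady-state notion `S` (everything else verbatim). -/
def CruxWithoutSBinding : Prop :=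
  ∀ ω₂ lam β γ : ℝ, 0 < ω₂ → 0 < lam → 0 < β → 0 < γ →
    ∀ S : ℝ → (N : ℕ) → ℝ → ℝ → Measure (PhaseSpace N) → Prop,
      ∀ T : ℝ, 0 < T → ∃ K ε₁ : ℝ, 0 < ε₁ ∧ ∀ ε : ℝ, 0 < ε → ε ≤ ε₁ →
        ∀ μ : (N : ℕ) → ℝ → ℝ → Measure (PhaseSpace N),
          (∀ (N : ℕ) (T_L T_R : ℝ), 0 < T_L → 0 < T_R →
              S ε N T_L T_R (μ N T_L T_R) ∧
                ∀ ν : Measure (PhaseSpace N), S ε N T_L T_R ν → ν = μ N T_L T_R) →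
          ∀ (D : ℕ → ℝ) (k : ℝ),
            (∀ N : ℕ, Tendsto (fun δ : ℝ =>
                (pinnedChain ω₂ lam β γ).totalCurrent (μ N (T + δ / 2) (T - δ / 2)) / δ)
              (𝓝[≠] 0) (𝓝 (D N))) →
            Tendsto D atTop (𝓝 k) → k ≤ K

/-- **Load-bearing: the defining equation of `S`.** With `S` free the statement is FALSE: take
`S ε N T_L T_R ν := (ν = caricature ε N T_L T_R)`; its unique "steady family" has `κ_ε = 1/ε`,
unbounded on every `(0, ε₁]`. Moral for provers: nothing in the quantifier skeleton bounds `k`;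
the bound must come out of the flip-steady-state equation `∫ (L + εS) f dμ = 0` itself, and it
must beat the `1/ε` law, which junk (and harmonic) families do realise. -/
theorem crux_false_without_SBinding : ¬ CruxWithoutSBinding := by
  intro h
  set P : OscillatorChain := pinnedChain 1 1 1 1 with hP
  have hV : deriv P.V 1 ≠ 0 := by
    rw [hP, pinnedChain_deriv_V]; norm_num
  obtain ⟨K, ε₁, hε₁, hK⟩ := h 1 1 1 1 one_pos one_pos one_pos one_pos
    (fun ε N T_L T_R ν => ν = caricature P ε N T_L T_R) 1 one_pos
  obtain ⟨ε, hε, hεε₁, hKε⟩ := exists_rate_inv_gt K hε₁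
  have hk : (1 / ε : ℝ) ≤ K :=
    hK ε hε hεε₁ (caricature P ε) (fun N T_L T_R _ _ => ⟨rfl, fun ν hν => hν⟩)
      (fun N => if 2 ≤ N then 1 / ε else 0) (1 / ε)
      (isResponse_caricature P hV hε.ne' 1) (tendsto_caricature_response ε)
  exact absurd hk (not_le.mpr hKε)

/-- **Load-bearing (junk reason): `0 < T`.** If the bound were asked at `T = 0`, the family
hypothesis — which binds `μ N T_L T_R` only for `T_L, T_R > 0` — says nothing about
`μ N (δ/2) (-δ/2)`, so a unique noisy family can be modified there into the caricature. Hence,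
GIVEN existence and uniqueness of the noisy family (clause (i) of `NoisyFourier`, not provable in
the tree today), `CruxAt P 0` fails. Provers: `0 < T` is used exactly once, to have
`T ± δ/2 > 0` for `|δ| < 2T` (`IsResponse.unique`). -/
theorem cruxAt_zero_false_of_exists_unique (P : OscillatorChain) (hV : deriv P.V 1 ≠ 0)
    (hex : ∀ ε : ℝ, 0 < ε → ∃ μ : (N : ℕ) → ℝ → ℝ → Measure (PhaseSpace N),
      IsUniqueFlipFamily P ε μ) :
    ¬ CruxAt P 0 := by
  rintro ⟨K, ε₁, hε₁, hK⟩
  obtain ⟨ε, hε, hεε₁, hKε⟩ := exists_rate_inv_gt K hε₁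
  obtain ⟨μu, hμu⟩ := hex ε hε
  -- the modified family: the unique noisy state at positive temperatures, the caricature elsewhere
  let μ : (N : ℕ) → ℝ → ℝ → Measure (PhaseSpace N) := fun N T_L T_R =>
    if 0 < T_L ∧ 0 < T_R then μu N T_L T_R else caricature P ε N T_L T_R
  have hμ : IsUniqueFlipFamily P ε μ := by
    intro N T_L T_R hL hR
    have : μ N T_L T_R = μu N T_L T_R := if_pos ⟨hL, hR⟩
    rw [this]
    exact hμu N T_L T_R hL hR
  have hD : IsResponse P μ 0 (fun N => if 2 ≤ N then 1 / ε else 0) := by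
    intro N
    have hc := isResponse_caricature P hV hε.ne' 0 N
    refine hc.congr' ?_
    filter_upwards [self_mem_nhdsWithin] with δ hδ
    have hjunk : ¬ (0 < (0 : ℝ) + δ / 2 ∧ 0 < 0 - δ / 2) := fun h => by linarith [h.1, h.2]
    simp only [μ, if_neg hjunk]
  have hk : (1 / ε : ℝ) ≤ K := hK ε hε hεε₁ μ hμ _ _ hD (tendsto_caricature_response ε)
  exact absurd hk (not_le.mpr hKε)

/-- **Load-bearing (trivially): the uniqueness clause is NOT, given `NoisyFourier` (i).** If the
noisy steady states are unique anyway (clause (i) of the sibling crux), the variant of the crux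
quantifying over ALL flip-steady families (uniqueness clause deleted from the hypothesis) is
equivalent to the crux. Recorded so that nobody spends time on the uniqueness clause: it only
matters in a world where `NoisyFourier` (i) fails, where the route is dead anyway. -/
theorem cruxAt_iff_forall_families_of_unique (P : OscillatorChain) (T : ℝ)
    (huniq : ∀ (ε : ℝ), 0 < ε → ∀ (N : ℕ) (T_L T_R : ℝ), 0 < T_L → 0 < T_R →
      ∀ μ ν : Measure (PhaseSpace N), P.IsFlipSteadyState N T_L T_R ε μ →
        P.IsFlipSteadyState N T_L T_R ε ν → μ = ν) :
    CruxAt P T ↔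
      ∃ K ε₁ : ℝ, 0 < ε₁ ∧ ∀ ε : ℝ, 0 < ε → ε ≤ ε₁ →
        ∀ μ : (N : ℕ) → ℝ → ℝ → Measure (PhaseSpace N),
          (∀ (N : ℕ) (T_L T_R : ℝ), 0 < T_L → 0 < T_R →
            P.IsFlipSteadyState N T_L T_R ε (μ N T_L T_R)) →
          ∀ (D : ℕ → ℝ) (k : ℝ), IsResponse P μ T D → Tendsto D atTop (𝓝 k) → k ≤ K := by
  constructor
  · rintro ⟨K, ε₁, hε₁, hK⟩
    refine ⟨K, ε₁, hε₁, fun ε hε hε' μ hμ D k hD hk => hK ε hε hε' μ ?_ D k hD hk⟩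
    exact fun N T_L T_R hL hR =>
      ⟨hμ N T_L T_R hL hR, fun ν hν => huniq ε hε N T_L T_R hL hR ν _ hν (hμ N T_L T_R hL hR)⟩
  · rintro ⟨K, ε₁, hε₁, hK⟩
    exact ⟨K, ε₁, hε₁, fun ε hε hε' μ hμ D k hD hk =>
      hK ε hε hε' μ (fun N T_L T_R hL hR => (hμ N T_L T_R hL hR).1) D k hD hk⟩

/-! ## §4 Near-misses: the excluded corners where the crux DOES fail (not closable in Lean today) -/

/-- **The killing shape.** Any lower bound `κ_ε(T) ≥ c/ε` (`c > 0`) along a sequence of rates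
`ε ↓ 0` at which the noisy conductivity is defined refutes the crux at `(P, T)` — this is the
common form of the harmonic law (`κ_ε = c/ε`, §4 below) and of a Mazur bound from a
flip-NON-invariant conserved quantity (`κ_ε ≳ Drude weight/ε`). So a disproof of
`VanishingNoiseBound` needs exactly: existence/uniqueness of the noisy family + convergence of its
responses + such a lower bound, for `pinnedChain` with `0 < ω₂, lam, β`. -/
theorem cruxAt_false_of_inv_lower_bound (P : OscillatorChain) (T : ℝ) {c : ℝ} (hc : 0 < c)
    (h : ∀ ε₁ : ℝ, 0 < ε₁ → ∃ ε : ℝ, 0 < ε ∧ ε ≤ ε₁ ∧ ∃ k ∈ noisyKappaSet P T ε, c / ε ≤ k) :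
    ¬ CruxAt P T := by
  rintro ⟨K, ε₁, hε₁, hK⟩
  -- a rate below ε₁ AND below c/(|K|+1), where c/ε > K
  obtain ⟨ε, hε, hεle, k, ⟨μ, D, hμ, hD, hk⟩, hck⟩ :=
    h (min ε₁ (c / (|K| + 1))) (lt_min hε₁ (by positivity))
  have hkK : k ≤ K := hK ε hε (le_trans hεle (min_le_left _ _)) μ hμ D k hD hk
  have hεc : ε ≤ c / (|K| + 1) := le_trans hεle (min_le_right _ _)
  have hlt : K < c / ε := by
    rw [lt_div_iff₀ hε]
    calc K * ε ≤ |K| * ε := by gcongr; exact le_abs_self K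
      _ < (|K| + 1) * ε := by gcongr; exact lt_add_one _
      _ ≤ (|K| + 1) * (c / (|K| + 1)) := by gcongr
      _ = c := by field_simp
  linarith

/-- **NEAR-MISS (harmonic corner, `lam = β = 0`, excluded by `0 < lam`, `0 < β`).** For the
pinned HARMONIC chain with velocity flips at every site between Langevin baths, Fourier's law
holds with `κ_ε(T) = (1/γ_S)/(2 + ν² + √(ν²(ν²+4)))`, `γ_S` the intensity of
`S = ½∑_j (f∘flip_j - f)` (Bernardin–Kannan–Lebowitz–Lukkarinen 2012, arXiv:1110.5432, §2 eq. for
`κ(T)`, p. 4, via Prop. 1 = the [DKL] covariance identity with the BLL2004 self-consistent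
chain; Bernardin–Olla 2011 Thm 3 for the unpinned chain, `lim n J_s = (T_ℓ - T_r)/(4γ)`). In the
present normalisation (rate `ε` per site, `ν² = ω₂`) `γ_S = 2ε` and
`κ_ε = (1/(2ε))/(2 + ω₂ + √(ω₂(ω₂+4))) ↑ ∞` as `ε ↓ 0`: `noisyKappaSet` is unbounded on every
`(0, ε₁]`, i.e. `¬ CruxAt (pinnedChain ω₂ 0 0 γ) T`. OBSTRUCTION to closing this in Lean: one needs,
for every `N, T_L, T_R > 0`, (i) existence AND weak uniqueness of the flip-steady state of the
harmonic chain (the state is not Gaussian — a mixture of Gaussians, BKLL2012 §2 — so the in-tree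
Lyapunov-equation NESS `HarmonicChainNESS` does not transfer; uniqueness of weak solutions of the
jump-diffusion Fokker–Planck equation is print-level only, "following the lines of [BO], [BO2]",
BKLL2012 p. 3), (ii) the closed second-moment equations giving `D_N(ε)` and (iii) their `N → ∞`
limit. Tried: nothing beyond locating the printed formula; the tree has no flip-noisy NESS at
`N ≥ 2` except the equilibrium Gibbs state (`pinnedChain_isFlipSteadyState_gibbsMeasure`). The
`sorry` below is EXACTLY this printed theorem (BKLL2012 §2 + noisy NESS uniqueness); the
reduction to it is `cruxAt_false_harmonic` (sorry-free given this lemma). -/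
theorem harmonic_noisyKappa_BKLL2012 (ω₂ γ T : ℝ) (hω : 0 < ω₂) (hγ : 0 < γ) (hT : 0 < T)
    (ε : ℝ) (hε : 0 < ε) :
    (1 / (2 * ε)) / (2 + ω₂ + Real.sqrt (ω₂ * (ω₂ + 4))) ∈
      noisyKappaSet (pinnedChain ω₂ 0 0 γ) T ε := by
  sorry

/-- **The harmonic corner kills the crux** (modulo the printed BKLL2012 law above):
`κ_ε = c(ω₂)/ε` with `c(ω₂) = (1/2)/(2 + ω₂ + √(ω₂(ω₂+4))) > 0`, so `cruxAt_false_of_inv_lower_bound`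
applies. This is why `0 < lam ∨ 0 < β` (some anharmonicity) is load-bearing. -/
theorem cruxAt_false_harmonic (ω₂ γ T : ℝ) (hω : 0 < ω₂) (hγ : 0 < γ) (hT : 0 < T) :
    ¬ CruxAt (pinnedChain ω₂ 0 0 γ) T := by
  have hden : 0 < 2 + ω₂ + Real.sqrt (ω₂ * (ω₂ + 4)) := by positivity
  refine cruxAt_false_of_inv_lower_bound _ T (c := (1 / 2) / (2 + ω₂ + Real.sqrt (ω₂ * (ω₂ + 4))))
    (by positivity) fun ε₁ hε₁ => ⟨ε₁, hε₁, le_rfl, _,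
      harmonic_noisyKappa_BKLL2012 ω₂ γ T hω hγ hT ε₁ hε₁, le_of_eq ?_⟩
  field_simp

/-- **NEAR-MISS (unpinned corner, `ω₂ = lam = 0`, excluded by `0 < ω₂`, `0 < lam`; numerical
only).** For the UNPINNED FPU-β chain with flips at every site between Langevin baths the
conductivity is numerically `κ_∞(ε) ~ ε^{-b}`, `b = 0.52 ± 0.06` (Landi–de Oliveira 2013,
arXiv:1305.0806, p. 6, fixed ends, `K₁ = K₂ = 1`; at `ε = 0` the momentum-conserving chain is
anomalous, `κ_L ~ L^{0.42}`), so the bound should fail there too; no theorem in print (for the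
unpinned chain with flips only the Green–Kubo convergence at fixed `ε` is proved, Bernardin–Olla
2011 Thm 2, with the upper bound `κ_ε ≤ Var(V′)/(4εT)` of Prop. 4 and no lower bound). Stated as a
`Prop` (conjecture), not claimed. -/
def UnpinnedCornerFails : Prop :=
  ∀ β γ T : ℝ, 0 < β → 0 < γ → 0 < T → ¬ CruxAt (pinnedChain 0 0 β γ) T

/-! ## §5 Numerics (kit compute) -/

/-- **NUMERICS LOG.** NEMD (BAOAB + Poisson flips) of `pinnedChain 1 1 1 1` with flips at rate `ε`
at every site, Langevin baths `γ = 1`, `T_L = T + δ/2`, `T_R = T - δ/2`; observable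
`D_N(ε) ≈ (N-1)·⟨j⟩/δ` (= `totalCurrent/δ`), two estimators (bond average / bath bookkeeping),
replica error bars; control = pinned harmonic chain against the exact BKLL2012 value
`κ_ε = 0.0955/ε` (`ω₂ = 1`). Jobs (script `nemd/main.py` of the disprover's folder, bundled in
each job; evidence auto-attached to stmt-AtomisticToContinuum-11976 on completion):
`[compute j012957]` COMPACT (`T = 1`, `δ = 0.4`, `N ∈ {32,64,128}`, `ε ∈ {0,.02,.05,.1,.2,.5}`;
harmonic control `N ∈ {64,128}`, `ε ∈ {.1,.2}`; `T = 0.2` at `N ∈ {64,128}`; small-`N`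
monotonicity `N ∈ {2,3,4,8}`, `ε ∈ {0,.1,.3,1,3}`) and `[compute j012960]` FULL (tag `long`:
`N` up to 256, `ε` down to 0.01, full statistics, plus strong pinning `lam = 5`); earlier ids
j004902/j005282 were cancelled and re-batched after 6 h in a saturated queue (cycle 1 ended with
both still QUEUED behind priority-94 traffic). QUESTIONS the tables answer: (1) is
`ε ↦ D_N(ε)` monotone decreasing at large `N` (Matthiessen ⇒ `sup_ε κ_ε = κ_0`)? (2) does
`D_N(0)` saturate in `N` by 128–256 at `T = 1` (finite `κ_0`)? (3) harmonic control within a few %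
of `0.0955/ε`? (4) is the resistivity increment `(1/D_N(ε) - 1/D_N(0))/ε` roughly `N`-independent
(bears on the sibling `NoiseLocality`)? (5) is monotonicity in `ε` violated at SMALL `N`
(noise-assisted transfer), which would kill the comparison principle of §1c as a finite-`N`
statement? PRINTED COMPARISON POINT: Guimarães–Landi–de Oliveira 2015 (arXiv:1511.06595,
pp. 6–7): Φ⁴-pinned chain + flips at every site + Langevin baths is diffusive at `λ = 0`
(`|J| = A/L`) and `J = b/(λL)` for large `λ` — flux decreasing in the flip rate, no small-`λ`
growth reported. RESULTS: not yet available at this revision; to be filled in by the next cycle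
(read `~/compute/j012957/outputs/summary.txt`). -/
theorem numerics_log : True := trivial

/-! ## §6 Verdict of this cycle -/

/-- **WHY THE CRUX RESISTS (cycle 1).**
1. No Lean refutation is reachable: `¬VanishingNoiseBound` requires exhibiting, for all small `ε`,
   THE unique flip-steady family of `pinnedChain` at every `N, T_L, T_R > 0` together with its
   response limits — the noisy NESS existence/uniqueness/response theory is print-level only
   (and at `N ≥ 2` only the equilibrium Gibbs state is in the tree).
2. No structural flaw: the statement elaborates, has no junk operators, is not vacuous at junk
   lengths (`N = 0`: Dirac mass is the unique flip-steady state; `N ≤ 1`: `D = 0`), and its only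
   cheap mutations behave as intended (§2–§3): pointwise-in-`ε` version trivial, `0 < ε₁` prevents
   vacuity, the `S`-binding and `0 < T` are load-bearing (for the right and for a junk reason
   respectively), the uniqueness clause is inert given `NoisyFourier` (i).
3. No slack: `FouriersLaw ∧ NoiseLocality → VanishingNoiseBound` (§1b) and the route's `closes`
   give `VanishingNoiseBound ↔ (κ(0) < ∞)` modulo the sibling items, so a counterexample inside
   `0 < ω₂, lam, β` would disprove Fourier's law for the pinned anharmonic chain (or noise
   locality). Every printed divergence of `κ_ε` as `ε ↓ 0` lives in an EXCLUDED corner (§4: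
   harmonic `c/ε`; unpinned FPU-β `ε^{-0.52}`; integrable Toda) and needs a conserved or
   ballistic structure that quartic pinning + quartic coupling destroy; no flip-non-invariant
   local conserved quantity of the `φ⁴`–FPU-β chain is known (Mazur route empty).
4. What WOULD kill it: (a) a hidden conserved quantity / stable ballistic mode of
   `pinnedChain ω₂ lam β` surviving at some `T` (breathers are flip-invariant in energy but not
   ballistic); (b) numerics showing `D_N(ε)` INCREASING without saturation as `ε ↓ 0` at fixed
   large `N` for the pinned chain (jobs j012957 / j012960 test this at `T = 1`, `0.2`); the one
   printed data point for a pinned anharmonic chain with flips (Guimarães–Landi–de Oliveira 2015)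
   goes the other way.
5. Bookkeeping: positive/structural lemmas of this file cannot be landed by a refuter seat (gate:
   only `¬ <Theses decl>` under `Theorems/`), so they travel as item evidence / this work file;
   nothing here closes or holds the item. -/
theorem verdict : True := trivial

end Summit.AtomisticToContinuum.FouriersLaw.Cruxes.VanishingNoiseBound.Disproof

end
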